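import Summits.PneNP.PneNP.Theorems.KrwChromaticSteeringStrongCompositionLrxDecoupling

/-!
# Crux line `lrx-gluing` (stmt-PneNP-18538), the glued adversary on `LRX_t` II: the adversary theorem, the root bound,
# `LRXQuantitative` PROVED

* `invAt_pad_of_lrx` — **the adversary theorem for `LRX_t`**: every subtree `N` that is `LRX_t`-disciplined from the typing `τ`
  satisfies the glued LRAD invariant `KrwLrad.InvAt` at the projection of `τ` ON THE PADDED TREE `KrwLrx.pad t N` (potential
  `ℓ + min K k ≤ depth N + 2 + t`): leaf / label / single-row test (incl. the type-B node via the landed `KrwLrb.transferB`) exactly as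
  the landed `KrwLrb.invAt_of_lrx`, transported along the padding by `invAt_of_run_depth`; an affine test of crossing weight `w ≤ t`
  by the type-A step (`KrwLrx.stub_crossingAlice/Bob`, `…LrxDecoupling.lean`) with `N := pad t (node)` and the subtrees padded by
  `t − w` — the budget bookkeeping `(t − w) + w + 1` is a depth identity of padded trees.
* `rect_bound_of_invAt` — the ROOT LEMMA (root state of the glued adversary as in the landed `KrwLrb.lrb_rect_bound`, stated for any
  tree playing like the protocol): the invariant at the all-fresh typing gives `ℓ + q ≤ depth + 2`;
  `lrx_rect_bound` — **`ℓ + q ≤ depth + t + 2`** for every `LRX_t` protocol; `lrxQuantitative_holds : LRXQuantitative` (`C = 1`, the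
  line's load-bearing statement, verbatim the skeleton); KRW form `exists_solves_of_lrxDisciplined`.

Skeleton `Cruxes/StrongComposition/Lines/lrx_gluing.lean` §6 (CLOSED, crux write dae79b7d2e87).  FRONTIER rung of the KRW programme;
the `t`-free LRA bound and C1 itself (stmt-PneNP-18538, all protocols) stay open; nothing here bears on P vs NP.
-/

set_option linter.dupNamespace false -- `Summit.PneNP.PneNP.…`: summit = sub-problem name (D-0017 single-conjunct layout)
set_option autoImplicit false

namespace Summit.PneNP.PneNP.Theorems.KrwLrx

open Literature.Computability.Complexity
open Summit.PneNP.PneNP.Theorems.KrwLrad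
open Summit.PneNP.PneNP.Theorems.KrwLrb

universe u

/-! ## The adversary theorem on `LRX_t`, the root bound, `LRXQuantitative` PROVED -/

section Main

variable {m n : ℕ} {g : (Fin n → Bool) → Bool} {q r : ℕ}

/-- **The adversary theorem for `LRX_t`**: every subtree `N` that is `LRX_t`-disciplined from the typing `τ` satisfies the glued
LRAD invariant at the projection of `τ` ON THE PADDED TREE `pad t N` (potential `ℓ + min K k ≤ depth N + 2 + t`).  Leaf, label
test, single-row test (incl. type B via `transferB`) as in the landed `KrwLrb.invAt_of_lrx`, transported along `pad` by
`invAt_of_run_depth`; affine test of weight `w ≤ t` by the type-A step (§5) with `N := pad t (node)`, the subtrees padded by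
`t − w`. -/
theorem invAt_pad_of_lrx (hgen : AffGeneric g r) (hqr : q + r + 1 ≤ n) (hsub : SubspaceHard g q)
    (hLU : PerRowLU g m q) (i₀ : Fin m) (j₀ : Fin n) :
    ∀ (N : KWTree (Fin m × Fin n)) (t : ℕ) (τ : Fin m → RowTypeX), LRXDisciplinedOn g t τ N →
      InvAt g q (fun i => (τ i).proj) (pad t N)
  | .leaf p, t, τ, _ => invAt_of_run_depth (run_pad t _) (by simp) (inv_leafAt hLU p _)
  | .alice s P Q, t, τ, h => by
    obtain ⟨τ', w, hN, hw, hP, hQ⟩ := h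
    have ihP := invAt_pad_of_lrx hgen hqr hsub hLU i₀ j₀ P (t - w) τ' hP
    have ihQ := invAt_pad_of_lrx hgen hqr hsub hLU i₀ j₀ Q (t - w) τ' hQ
    have hrun : ∀ X Y, (pad t (KWTree.alice s P Q)).run X Y
        = (KWTree.alice s (pad (t - w) P) (pad (t - w) Q)).run X Y := fun X Y => by
      simp only [run_pad, KWTree.run_alice]
    have hd : (KWTree.alice s (pad (t - w) P) (pad (t - w) Q)).depth + w
        = (pad t (KWTree.alice s P Q)).depth := depth_alice_pad_add s P Q hw
    rcases hN with ⟨⟨φ, hφ⟩, hτ', hw0⟩ | ⟨U, c, hs, hτ', hW⟩ | ⟨i, ψ, hs, hτ', hw0⟩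
    · subst hτ'
      exact invAt_of_run_depth hrun (by omega) (label_stepAt_alice i₀ hφ ihP ihQ)
    · subst hτ'
      exact stub_crossingAlice m n q g hLU i₀ j₀ τ s _ _ _ U c hs ihP ihQ hrun (by rw [← hW]; omega)
    · subst hτ'
      rw [proj_update_combinatorial] at ihP ihQ
      refine invAt_of_run_depth hrun (by omega) ?_
      by_cases hτi : (τ i).proj = RowType.algebraic
      · refine transferB hgen hqr hsub (τ := fun i' => (τ i').proj) hτi ?_
        refine row_stepAt_alice i₀ j₀ hs (by simp) ?_ ?_
        · rwa [Function.update_idem]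
        · rwa [Function.update_idem]
      · exact row_stepAt_alice i₀ j₀ hs hτi ihP ihQ
  | .bob s P Q, t, τ, h => by
    obtain ⟨τ', w, hN, hw, hP, hQ⟩ := h
    have ihP := invAt_pad_of_lrx hgen hqr hsub hLU i₀ j₀ P (t - w) τ' hP
    have ihQ := invAt_pad_of_lrx hgen hqr hsub hLU i₀ j₀ Q (t - w) τ' hQ
    have hrun : ∀ X Y, (pad t (KWTree.bob s P Q)).run X Y
        = (KWTree.bob s (pad (t - w) P) (pad (t - w) Q)).run X Y := fun X Y => by
      simp only [run_pad, KWTree.run_bob]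
    have hd : (KWTree.bob s (pad (t - w) P) (pad (t - w) Q)).depth + w
        = (pad t (KWTree.bob s P Q)).depth := depth_bob_pad_add s P Q hw
    rcases hN with ⟨⟨φ, hφ⟩, hτ', hw0⟩ | ⟨U, c, hs, hτ', hW⟩ | ⟨i, ψ, hs, hτ', hw0⟩
    · subst hτ'
      exact invAt_of_run_depth hrun (by omega) (label_stepAt_bob i₀ hφ ihP ihQ)
    · subst hτ'
      exact stub_crossingBob m n q g hLU i₀ j₀ τ s _ _ _ U c hs ihP ihQ hrun (by rw [← hW]; omega)
    · subst hτ'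
      rw [proj_update_combinatorial] at ihP ihQ
      refine invAt_of_run_depth hrun (by omega) ?_
      by_cases hτi : (τ i).proj = RowType.algebraic
      · refine transferB hgen hqr hsub (τ := fun i' => (τ i').proj) hτi ?_
        refine row_stepAt_bob i₀ j₀ hs (by simp) ?_ ?_
        · rwa [Function.update_idem]
        · rwa [Function.update_idem]
      · exact row_stepAt_bob i₀ j₀ hs hτi ihP ihQ

/-- **Root lemma** (the root state of the glued adversary, as in the landed `KrwLrb.lrb_rect_bound`, for ANY tree `N` playing like
the protocol `P`): if `N` satisfies the invariant at the all-fresh typing then `ℓ + q ≤ depth N + 2`. -/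
theorem rect_bound_of_invAt {f : (Fin m → Bool) → Bool} {ℓ : ℕ} (hf : ∃ a b, f a = true ∧ f b = false)
    (hgen : AffGeneric g r) (hqr : q + r + 1 ≤ n) (hsub : SubspaceHard g q) (hq : 1 ≤ q)
    (hH : Hard (f ⁻¹' {true}) (f ⁻¹' {false}) ℓ) {P N : KWTree (Fin m × Fin n)}
    (hrunN : ∀ X Y, N.run X Y = P.run X Y) (hsol : P.SolvesStrong f g)
    (hI : InvAt g q (fun _ => RowType.fresh) N) : ℓ + q ≤ N.depth + 2 := by
  classical
  -- `m ≥ 1` (f non-constant) and a coordinate `i₀`; `n ≥ 1` and a coordinate `j₀`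
  obtain ⟨a₁, b₁, hfa₁, hfb₁⟩ := hf
  have hm : 0 < m := by
    rcases Nat.eq_zero_or_pos m with h0 | h0
    · exfalso
      subst h0
      have : a₁ = b₁ := funext fun i => i.elim0
      rw [this, hfb₁] at hfa₁
      exact Bool.false_ne_true hfa₁
    · exact h0
  let i₀ : Fin m := ⟨0, hm⟩
  let j₀ : Fin n := ⟨0, by omega⟩
  -- the row game of `g` itself is `q`-hard (subspace-hardness on the empty system); `g` takes both values
  have hKW : Hard {x | (∀ e ∈ ([] : List (Finset (Fin n) × Bool)), rowParity e.1 x = e.2) ∧ g x = true}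
      {x | (∀ e ∈ ([] : List (Finset (Fin n) × Bool)), rowParity e.1 x = e.2) ∧ g x = false} q := by
    simpa using hsub [] (by simp) ⟨fun _ => false, by simp⟩
  have hsetα : ∀ α : Bool, {x | (∀ e ∈ ([] : List (Finset (Fin n) × Bool)), rowParity e.1 x = e.2) ∧ g x = α}
      = RA g (fun _ : Fin m => (Set.univ : Set (Fin n → Bool))) i₀ α := by
    intro α; ext x; simp [RA]
  obtain ⟨u, hu⟩ := hKW.nonempty_left hq j₀
  obtain ⟨v, hv⟩ := hKW.nonempty_right hq j₀
  have hgu : g u = true := by simpa using hu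
  have hgv : g v = false := by simpa using hv
  have hgα : ∀ α : Bool, ∃ x, g x = α := fun α => by cases α; exacts [⟨v, hgv⟩, ⟨u, hgu⟩]
  -- per-row label-universality with budget `q ≤ n - r - 1`
  have hLU : PerRowLU g m q :=
    perRowLU_mono (by omega) (perRowLUOfGeneric_holds m n r g ⟨u, v, hgu, hgv⟩ hgen)
  -- the root state
  let U : Fin m → Set (Fin n → Bool) := fun _ => Set.univ
  set A : Set (Fin m → Bool) := f ⁻¹' {true} with hA
  set B : Set (Fin m → Bool) := f ⁻¹' {false} with hB
  have hAE_A : AE g A U = A := AE_root hgα A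
  have hAE_B : AE g B U = B := AE_root hgα B
  have hst : StateOK (fun _ : Fin m => RowType.fresh) U U ([] : AffSys m n) := fun i =>
    ⟨fun _ => rowLoad_nil i, fun _ => ⟨rfl, rfl⟩⟩
  have hsat0 : ∃ X, Sat ([] : AffSys m n) X := ⟨fun _ => false, fun e he => by simp at he⟩
  have hload : ∀ i, rowLoad ([] : AffSys m n) i + q ≤ q := fun i => by rw [rowLoad_nil, Nat.zero_add]
  have hV : ValidOnE g N A B U U [] := by
    intro X hX Y hY
    have hX1 : f (rowLabels g X) = true := by simpa [hA] using hX.1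
    have hY1 : f (rowLabels g Y) = false := by simpa [hB] using hY.1
    rw [hrunN X Y]
    exact hsol X Y (by rw [blockComp_apply]; exact hX1) (by rw [blockComp_apply]; exact hY1)
  have hD : ∀ a ∈ AE g A U, ∀ b ∈ AE g B U, a ≠ b := by
    rw [hAE_A, hAE_B]
    rintro a ha b hb rfl
    have ha' : f a = true := by simpa [hA] using ha
    have hb' : f a = false := by simpa [hB] using hb
    rw [ha'] at hb'
    exact Bool.noConfusion hb'
  have hneA : (AE g A U).Nonempty := by rw [hAE_A]; exact ⟨a₁, by simpa [hA] using hfa₁⟩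
  have hneB : (AE g B U).Nonempty := by rw [hAE_B]; exact ⟨b₁, by simpa [hB] using hfb₁⟩
  have hL : Hard (AE g A U) (AE g B U) ℓ := by rw [hAE_A, hAE_B]; exact hH
  have hR : ∀ i α, Alive g A B U U i α → Hard (RA g U i α) (RA g U i (!α)) q := by
    intro i α _
    have hi : ∀ β, RA g U i β = RA g U i₀ β := fun β => rfl
    rw [hi, hi, ← hsetα, ← hsetα]
    cases α
    · exact hard_swap hKW
    · exact hKW
  have hK : ∀ i α, Alive g A B U U i α → q ≤ q + cst (AE g A U) i + cst (AE g B U) i :=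
    fun _ _ _ => by omega
  have hmain := hI A B U U [] q hst hsat0 hload hV hD hneA hneB ℓ q (fun _ _ => q) hL hR hK
  rwa [Nat.min_self] at hmain

/-- **The glued adversary bound on `LRX_t`, sharp form**: `ℓ + q ≤ depth + t + 2` for every `LRX_t` protocol for `KW_f ⊛ KW_g`,
`f` non-constant with `ℓ`-hard KW rectangle, `g` `r`-affine-generic and subspace-hard with budget `q ≥ 1`, `q + r + 1 ≤ n`. -/
theorem lrx_rect_bound {f : (Fin m → Bool) → Bool} {ℓ : ℕ} (hf : ∃ a b, f a = true ∧ f b = false)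
    (hgen : AffGeneric g r) (hqr : q + r + 1 ≤ n) (hsub : SubspaceHard g q) (hq : 1 ≤ q)
    (hH : Hard (f ⁻¹' {true}) (f ⁻¹' {false}) ℓ) {t : ℕ} {P : KWTree (Fin m × Fin n)} (hP : LRXDisciplined g t P)
    (hsol : P.SolvesStrong f g) : ℓ + q ≤ P.depth + t + 2 := by
  classical
  obtain ⟨a₁, b₁, hfa₁, hfb₁⟩ := hf
  have hm : 0 < m := by
    rcases Nat.eq_zero_or_pos m with h0 | h0
    · exfalso
      subst h0
      have : a₁ = b₁ := funext fun i => i.elim0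
      rw [this, hfb₁] at hfa₁
      exact Bool.false_ne_true hfa₁
    · exact h0
  let i₀ : Fin m := ⟨0, hm⟩
  let j₀ : Fin n := ⟨0, by omega⟩
  -- `g` takes both values (subspace-hardness on the empty system), so per-row label-universality holds with budget `q`
  have hKW : Hard {x | (∀ e ∈ ([] : List (Finset (Fin n) × Bool)), rowParity e.1 x = e.2) ∧ g x = true}
      {x | (∀ e ∈ ([] : List (Finset (Fin n) × Bool)), rowParity e.1 x = e.2) ∧ g x = false} q := by
    simpa using hsub [] (by simp) ⟨fun _ => false, by simp⟩
  obtain ⟨u, hu⟩ := hKW.nonempty_left hq j₀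
  obtain ⟨v, hv⟩ := hKW.nonempty_right hq j₀
  have hgu : g u = true := by simpa using hu
  have hgv : g v = false := by simpa using hv
  have hLU : PerRowLU g m q :=
    perRowLU_mono (by omega) (perRowLUOfGeneric_holds m n r g ⟨u, v, hgu, hgv⟩ hgen)
  have hI := invAt_pad_of_lrx hgen hqr hsub hLU i₀ j₀ P t (fun _ => RowTypeX.fresh) hP
  have h := rect_bound_of_invAt ⟨a₁, b₁, hfa₁, hfb₁⟩ hgen hqr hsub hq hH (run_pad t P) hsol hI
  rw [depth_pad] at h
  omega

/-- **`LRXQuantitative` PROVED** (constant `C = 1`), from the sharp form `lrx_rect_bound`. -/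
theorem lrxQuantitative_holds : LRXQuantitative := by
  refine ⟨1, ?_⟩
  intro m n q r ℓ t f g hf hgen hqr hsub hq hH P hP hsol
  have h := lrx_rect_bound hf hgen hqr hsub hq hH hP hsol
  omega

/-- KRW form of the bound: from any `LRX_t` protocol `P` for `KW_f ⊛ KW_g` (`f` non-constant, `g` `r`-generic and subspace-hard
with budget `q ≥ 1`, `q + r + 1 ≤ n`) a `KW_f` protocol `Q` with `Q.depth + q ≤ P.depth + t + 2`. -/
theorem exists_solves_of_lrxDisciplined {f : (Fin m → Bool) → Bool} (hf : ∃ a b, f a ≠ f b)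
    (hgen : AffGeneric g r) (hqr : q + r + 1 ≤ n) (hsub : SubspaceHard g q) (hq : 1 ≤ q)
    {t : ℕ} {P : KWTree (Fin m × Fin n)} (hP : LRXDisciplined g t P) (hsol : P.SolvesStrong f g) :
    ∃ Q : KWTree (Fin m), Q.Solves f ∧ Q.depth + q ≤ P.depth + t + 2 := by
  classical
  have hne : ∃ a b, f a = true ∧ f b = false := by
    obtain ⟨a, b, hab⟩ := hf
    cases ha : f a <;> cases hb : f b
    · rw [ha, hb] at hab; exact absurd rfl hab
    · exact ⟨b, a, hb, ha⟩
    · exact ⟨a, b, ha, hb⟩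
    · rw [ha, hb] at hab; exact absurd rfl hab
  by_contra hcon
  push Not at hcon
  set ℓ := P.depth + t + 3 - q with hℓ
  have hH : Hard (f ⁻¹' {true}) (f ⁻¹' {false}) ℓ := by
    intro Q hQ
    have hs : Q.Solves f := fun a b ha hb => hQ a (by simpa using ha) b (by simpa using hb)
    have := hcon Q hs
    omega
  have hmain := lrx_rect_bound hne hgen hqr hsub hq hH hP hsol
  omega

end Main
end Summit.PneNP.PneNP.Theorems.KrwLrx
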